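import Summits.SmoothPoincare4.SmoothPoincare4.Theorems.SymplecticOrigamiOrigamiFoldExistenceStubOuterCleanRecognitionChartCapProfile
import Summits.SmoothPoincare4.SmoothPoincare4.Theorems.SymplecticOrigamiOrigamiFoldExistenceStubOuterCleanRecognitionChartChimney
import Literature.Topology.FourManifolds.PalaisBallComplement

/-!
# Stub `stub_outerCleanRecognitionChart` of line `shadow-pleats` for crux `OrigamiFoldExistence` — N:
# the CAP MAP `S⁴ ⊃ {h ≤ 1 − δ} → S⁴ ∖ λ(B_ρ)` (item stmt-SmoothPoincare4-7844, route SymplecticOrigami; seat c3, S4''-chart worker)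

Fourteenth helper file towards `stub_outerCleanRecognitionChart : OuterCleanRecognitionChart`, over
file M (`…CapProfile`: the profile `P = capP δ`, positive on `(−∞,1)`, `= 1 − t²` on the band
`t ≥ (1−δ)/2`, `= 2(1−t)` near `t = −1`, with strictly increasing radial profile
`Q = √(1−t²)/P` on `[−1, 1)`, `Q(1−δ) = 1/ρ`).  THE CAP MAP
    `capMap δ q = R_N (λ ((4 / P(q₄)) • proj5 q))`,   `λ = liftS4 = σ_N⁻¹`,
`R_N` the reflection of `S⁴` in the equatorial hyperplane (tree: `poleReflectionSphere`,
`PalaisBallComplement`), defined and SMOOTH on all of `{q ∈ ℝ⁵ | q₄ < 1}` (`contMDiffOn_capMap`):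

* `capMap_eq_liftS4_proj5` — on the band `{(1−δ)/2 ≤ q₄ < 1}` of the unit sphere it IS
  `λ ∘ proj5` (the inversion formula `R_N λ(4z/‖z‖²) = λ z` of the tree,
  `poleReflection_stereographic'_symm`);
* `capMap_eq_liftS4_smul` — off the south pole it is `q ↦ λ((P(q₄)/(1 − q₄²)) proj5 q)`, a point
  of `λ`-radius `1/Q(q₄) ≥ ρ`; `capMap_of_proj5_eq_zero`: the south pole goes to `N`;
* `injOn_capMap` — INJECTIVE on the cap `{‖q‖ = 1, q₄ ≤ 1 − δ}` (strict monotonicity of `Q`);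
* **`image_capMap`** (registered helper) — it maps that cap ONTO `S⁴ ∖ λ(B_ρ)`,
  `ρ = √(1 − (1−δ)²)` (intermediate values of `Q`).

Immersivity (injective differential on the cap) is file O.  With these, the map
`Ψ = capMap ∘ ι` on the round part `{h ≤ 1 − δ}` of a round-rim position glues smoothly to
`λ ∘ shadow` above the plane (they agree on the band) — the far part of the structure map of
(O2)(d).

Sources: the tree's `PalaisBallComplement` (inversion formula, equatorial reflection); the lead's
`OuterClean-analysis-c3.md` §3 (O2)(d).
-/

noncomputable section

-- the prescribed namespace `Summit.<P>.<Sub>.…` duplicates `SmoothPoincare4` (P = Sub)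
set_option linter.dupNamespace false

open scoped Manifold ContDiff Topology RealInnerProductSpace
open Set Function Filter Metric
open Literature.Topology.FourManifolds

namespace Summit.SmoothPoincare4.SmoothPoincare4.Theorems.OrigamiFoldExistence.ShadowPleats

/-! ### Definition and smoothness -/

/-- The PRE-MAP `q ↦ (4 / P(q₄)) • proj5 q : ℝ⁵ → ℝ⁴`. -/
def capPre (δ : ℝ) (q : EuclideanSpace ℝ (Fin 5)) : EuclideanSpace ℝ (Fin 4) := (4 / capP δ (q 4)) • proj5 q

/-- THE CAP MAP `q ↦ R_N (λ ((4 / P(q₄)) • proj5 q)) : ℝ⁵ → S⁴`. -/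
def capMap (δ : ℝ) (q : EuclideanSpace ℝ (Fin 5)) : Metric.sphere (0 : EuclideanSpace ℝ (Fin 5)) 1 :=
  poleReflectionSphere (n := 4) northPole (liftS4 (capPre δ q))

section Basic

variable {δ : ℝ}

/-- The cap map in coordinates. -/
theorem coe_capMap (δ : ℝ) (q : EuclideanSpace ℝ (Fin 5)) :
    ((capMap δ q : Metric.sphere (0 : EuclideanSpace ℝ (Fin 5)) 1) : EuclideanSpace ℝ (Fin 5)) =
      poleReflection northPole ((liftS4 (capPre δ q) : Metric.sphere (0 : EuclideanSpace ℝ (Fin 5)) 1) :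
        EuclideanSpace ℝ (Fin 5)) := rfl

/-- The reflection of the sphere is injective (it is an involution). -/
theorem poleReflectionSphere_injective :
    Injective (poleReflectionSphere (n := 4) (northPole : Metric.sphere (0 : EuclideanSpace ℝ (Fin 5)) 1)) :=
  fun a b hab => by
    have := congrArg (poleReflectionSphere (n := 4) northPole) hab
    rwa [poleReflectionSphere_poleReflectionSphere, poleReflectionSphere_poleReflectionSphere] at this

/-- The coefficient `4 / P(q₄)` is smooth on `{q₄ < 1}` (for `δ < 1`). -/
theorem contDiffOn_capCoeff (hδ1 : δ < 1) :
    ContDiffOn ℝ ∞ (fun q : EuclideanSpace ℝ (Fin 5) => 4 / capP δ (q 4)) {q | q 4 < 1} := by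
  have h1 : ContDiff ℝ ∞ fun q : EuclideanSpace ℝ (Fin 5) => capP δ (q 4) := by
    have : ContDiff ℝ ∞ fun q : EuclideanSpace ℝ (Fin 5) => capP δ (heightL q) := (contDiff_capP δ).comp heightL.contDiff
    simpa using this
  exact contDiffOn_const.div h1.contDiffOn fun q hq => (capP_pos hδ1 hq).ne'

/-- The pre-map is smooth on `{q₄ < 1}`. -/
theorem contDiffOn_capPre (hδ1 : δ < 1) : ContDiffOn ℝ ∞ (capPre δ) {q : EuclideanSpace ℝ (Fin 5) | q 4 < 1} := by
  have h2 : ContDiff ℝ ∞ (proj5 : EuclideanSpace ℝ (Fin 5) → EuclideanSpace ℝ (Fin 4)) := by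
    rw [← coe_proj5L]; exact proj5L.contDiff
  exact (contDiffOn_capCoeff hδ1).smul h2.contDiffOn

/-- `{q₄ < 1}` is open. -/
theorem isOpen_setOf_apply_four_lt (c : ℝ) : IsOpen {q : EuclideanSpace ℝ (Fin 5) | q 4 < c} := by
  have : Continuous fun q : EuclideanSpace ℝ (Fin 5) => heightL q := heightL.continuous
  simpa using isOpen_lt this continuous_const

/-- **THE CAP MAP IS SMOOTH on `{q₄ < 1}`.** -/
theorem contMDiffOn_capMap (hδ1 : δ < 1) :
    ContMDiffOn 𝓘(ℝ, EuclideanSpace ℝ (Fin 5)) (𝓡 4) ∞ (capMap δ) {q : EuclideanSpace ℝ (Fin 5) | q 4 < 1} := by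
  have h1 : ContMDiffOn 𝓘(ℝ, EuclideanSpace ℝ (Fin 5)) 𝓘(ℝ, EuclideanSpace ℝ (Fin 4)) ∞ (capPre δ) {q | q 4 < 1} :=
    (contDiffOn_capPre hδ1).contMDiffOn
  have h2 := contMDiff_liftS4.comp_contMDiffOn h1
  exact (poleReflectionSphere (n := 4) northPole).contMDiff.comp_contMDiffOn h2

/-- The cap map is `C^∞` at every point of `{q₄ < 1}`. -/
theorem contMDiffAt_capMap (hδ1 : δ < 1) {q : EuclideanSpace ℝ (Fin 5)} (hq : q 4 < 1) :
    ContMDiffAt 𝓘(ℝ, EuclideanSpace ℝ (Fin 5)) (𝓡 4) ∞ (capMap δ) q :=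
  (contMDiffOn_capMap hδ1).contMDiffAt ((isOpen_setOf_apply_four_lt 1).mem_nhds hq)

/-! ### The inversion formula and the values of the cap map -/

/-- **The inversion formula in `S⁴`**: `R_N (λ z) = λ ((4/‖z‖²) z)` for `z ≠ 0`. -/
theorem poleReflectionSphere_liftS4 {z : EuclideanSpace ℝ (Fin 4)} (hz : z ≠ 0) :
    poleReflectionSphere (n := 4) northPole (liftS4 z) = liftS4 ((4 / ‖z‖ ^ 2) • z) :=
  Subtype.ext (poleReflection_stereographic'_symm northPole hz)

/-- The south pole is sent to the north pole: `capMap` of a point with zero shadow is `N`. -/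
theorem capMap_of_proj5_eq_zero {q : EuclideanSpace ℝ (Fin 5)} (hq : proj5 q = 0) : capMap δ q = northPole := by
  apply Subtype.ext
  rw [coe_capMap, capPre, hq, smul_zero]
  rw [show ((liftS4 (0 : EuclideanSpace ℝ (Fin 4)) : Metric.sphere (0 : EuclideanSpace ℝ (Fin 5)) 1) : EuclideanSpace ℝ (Fin 5)) =
    -((northPole : Metric.sphere (0 : EuclideanSpace ℝ (Fin 5)) 1) : EuclideanSpace ℝ (Fin 5)) from coe_stereographic'_symm_zero northPole]
  rw [map_neg, poleReflection_apply_pole, neg_neg]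

/-- **Off the south pole the cap map is `λ ((P(q₄)/(1 − q₄²)) proj5 q)`** (`q` on the unit sphere). -/
theorem capMap_eq_liftS4_smul (hδ1 : δ < 1) {q : EuclideanSpace ℝ (Fin 5)} (hq1 : ‖q‖ = 1) (hq4 : q 4 < 1)
    (hx : proj5 q ≠ 0) : capMap δ q = liftS4 ((capP δ (q 4) / (1 - (q 4) ^ 2)) • proj5 q) := by
  have hP := capP_pos hδ1 hq4
  have hxsq : ‖proj5 q‖ ^ 2 = 1 - (q 4) ^ 2 := norm_proj5_sq_of_mem_sphere (by simpa using hq1)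
  have hx0 : 0 < ‖proj5 q‖ := norm_pos_iff.2 hx
  have hz : capPre δ q ≠ 0 := by
    rw [capPre]; exact smul_ne_zero (div_ne_zero four_ne_zero hP.ne') hx
  show poleReflectionSphere (n := 4) northPole (liftS4 (capPre δ q)) = _
  rw [poleReflectionSphere_liftS4 hz, capPre, smul_smul, norm_smul, Real.norm_of_nonneg (by positivity), mul_pow,
    hxsq]
  congr 1
  have h1t : (1 : ℝ) - q 4 ^ 2 ≠ 0 := by rw [← hxsq]; positivity
  field_simp

/-- **ON THE BAND `{(1−δ)/2 ≤ q₄ < 1}` THE CAP MAP IS `λ ∘ proj5`.** -/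
theorem capMap_eq_liftS4_proj5 (hδ1 : δ < 1) {q : EuclideanSpace ℝ (Fin 5)} (hq1 : ‖q‖ = 1) (hq4 : q 4 < 1)
    (hband : (1 - δ) / 2 ≤ q 4) : capMap δ q = liftS4 (proj5 q) := by
  have hxsq : ‖proj5 q‖ ^ 2 = 1 - (q 4) ^ 2 := norm_proj5_sq_of_mem_sphere (by simpa using hq1)
  have h1t : 0 < 1 - (q 4) ^ 2 := by nlinarith
  have hx : proj5 q ≠ 0 := by
    rw [← norm_pos_iff]; nlinarith [norm_nonneg (proj5 q), hxsq]
  rw [capMap_eq_liftS4_smul hδ1 hq1 hq4 hx, capP_of_ge hδ1 hband, div_self h1t.ne', one_smul]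

/-- The `λ`-radius of the cap map off the south pole is `1/Q(q₄)`. -/
theorem norm_capRadius (hδ1 : δ < 1) {q : EuclideanSpace ℝ (Fin 5)} (hq1 : ‖q‖ = 1) (hq4 : q 4 < 1) (hx : proj5 q ≠ 0) :
    ‖(capP δ (q 4) / (1 - (q 4) ^ 2)) • proj5 q‖ = (capQ δ (q 4))⁻¹ := by
  have hP := capP_pos hδ1 hq4
  have hxsq : ‖proj5 q‖ ^ 2 = 1 - (q 4) ^ 2 := norm_proj5_sq_of_mem_sphere (by simpa using hq1)
  have hx0 : 0 < ‖proj5 q‖ := norm_pos_iff.2 hx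
  have h1t : 0 < 1 - (q 4) ^ 2 := by rw [← hxsq]; positivity
  have hsq : Real.sqrt (1 - (q 4) ^ 2) = ‖proj5 q‖ := by rw [← hxsq, Real.sqrt_sq hx0.le]
  rw [norm_smul, Real.norm_of_nonneg (div_nonneg hP.le h1t.le), capQ, hsq, inv_div, ← hxsq]
  field_simp

/-- A point of the unit sphere has fourth coordinate in `[−1, 1]`. -/
theorem abs_apply_four_le {q : EuclideanSpace ℝ (Fin 5)} (hq1 : ‖q‖ = 1) : |q 4| ≤ 1 := by
  have h := norm_sq_eq_norm_proj5_sq_add_sq q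
  rw [hq1, one_pow] at h
  rw [abs_le]
  constructor <;> nlinarith [norm_nonneg (proj5 q)]

/-- On the unit sphere, zero shadow means `q₄ = ±1`; below `1` it means `q₄ = −1`. -/
theorem apply_four_eq_neg_one {q : EuclideanSpace ℝ (Fin 5)} (hq1 : ‖q‖ = 1) (hq4 : q 4 < 1) (hx : proj5 q = 0) :
    q 4 = -1 := by
  have h := norm_sq_eq_norm_proj5_sq_add_sq q
  rw [hq1, one_pow, hx, norm_zero] at h
  nlinarith

/-- Below `1`, non-zero shadow means `−1 < q₄`. -/
theorem neg_one_lt_apply_four {q : EuclideanSpace ℝ (Fin 5)} (hq1 : ‖q‖ = 1) (hx : proj5 q ≠ 0) : -1 < q 4 := by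
  have h := norm_sq_eq_norm_proj5_sq_add_sq q
  rw [hq1, one_pow] at h
  have hx0 : 0 < ‖proj5 q‖ := norm_pos_iff.2 hx
  have hle := abs_apply_four_le hq1
  rw [abs_le] at hle
  rcases hle.1.lt_or_eq with hlt | heq
  · exact hlt
  · nlinarith

/-! ### Injectivity and image on the cap `{‖q‖ = 1, q₄ ≤ 1 − δ}` -/

/-- **THE CAP MAP IS INJECTIVE ON THE CAP `{‖q‖ = 1, q₄ ≤ 1 − δ}`.** -/
theorem injOn_capMap (hδ : 0 < δ) (hδ1 : δ < 1) :
    InjOn (capMap δ) {q : EuclideanSpace ℝ (Fin 5) | ‖q‖ = 1 ∧ q 4 ≤ 1 - δ} := by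
  rintro q ⟨hq1, hq4⟩ q' ⟨hq'1, hq'4⟩ heq
  have hq4' : q 4 < 1 := by linarith
  have hq'4' : q' 4 < 1 := by linarith
  have hpre : capPre δ q = capPre δ q' := liftS4_injective (poleReflectionSphere_injective heq)
  -- the radial profiles agree, so the heights agree
  have hP := capP_pos hδ1 hq4'
  have hP' := capP_pos hδ1 hq'4'
  have hnorm := congrArg norm hpre
  rw [capPre, capPre, norm_smul, norm_smul, Real.norm_of_nonneg (by positivity), Real.norm_of_nonneg (by positivity)] at hnorm
  have hxq : ‖proj5 q‖ = Real.sqrt (1 - (q 4) ^ 2) := by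
    rw [← norm_proj5_sq_of_mem_sphere (by simpa using hq1), Real.sqrt_sq (norm_nonneg _)]
  have hxq' : ‖proj5 q'‖ = Real.sqrt (1 - (q' 4) ^ 2) := by
    rw [← norm_proj5_sq_of_mem_sphere (by simpa using hq'1), Real.sqrt_sq (norm_nonneg _)]
  have hQ : capQ δ (q 4) = capQ δ (q' 4) := by
    rw [capQ, capQ, ← hxq, ← hxq']
    field_simp at hnorm ⊢
    linarith
  have hle := abs_apply_four_le hq1
  have hle' := abs_apply_four_le hq'1
  rw [abs_le] at hle hle'
  have ht : q 4 = q' 4 := (strictMonoOn_capQ hδ1).injOn ⟨hle.1, hq4'⟩ ⟨hle'.1, hq'4'⟩ hQ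
  -- hence the shadows agree, hence the points
  have hx : proj5 q = proj5 q' := by
    rw [capPre, capPre, ht] at hpre
    exact smul_right_injective _ (div_ne_zero four_ne_zero hP'.ne') hpre
  rw [← embedL_proj5_add_smul q, ← embedL_proj5_add_smul q', hx, ht]

/-- The cap maps into the complement of the lifted open ball `λ(B_ρ)`. -/
theorem capMap_notMem_image_ball (hδ : 0 < δ) (hδ1 : δ < 1) {q : EuclideanSpace ℝ (Fin 5)} (hq1 : ‖q‖ = 1)
    (hq4 : q 4 ≤ 1 - δ) : capMap δ q ∉ liftS4 '' Metric.ball 0 (Real.sqrt (1 - (1 - δ) ^ 2)) := by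
  rintro ⟨w, hw, hwq⟩
  have hq4' : q 4 < 1 := by linarith
  by_cases hx : proj5 q = 0
  · rw [capMap_of_proj5_eq_zero hx] at hwq
    exact liftS4_ne_northPole w hwq
  · rw [capMap_eq_liftS4_smul hδ1 hq1 hq4' hx] at hwq
    have hw' := congrArg norm (liftS4_injective hwq)
    rw [norm_capRadius hδ1 hq1 hq4' hx] at hw'
    have hρ : 0 < Real.sqrt (1 - (1 - δ) ^ 2) := Real.sqrt_pos.2 (by nlinarith)
    have hQpos : 0 < capQ δ (q 4) := capQ_pos hδ1 (neg_one_lt_apply_four hq1 hx) hq4'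
    have hQle : capQ δ (q 4) ≤ (Real.sqrt (1 - (1 - δ) ^ 2))⁻¹ :=
      capQ_le hδ hδ1 (abs_le.1 (abs_apply_four_le hq1)).1 hq4
    have : Real.sqrt (1 - (1 - δ) ^ 2) ≤ (capQ δ (q 4))⁻¹ := by
      rw [le_inv_comm₀ hρ hQpos]; exact hQle
    rw [← hw'] at this
    exact absurd (mem_ball_zero_iff.1 hw) (not_lt.2 this)

/-- **THE CAP MAP MAPS THE CAP `{‖q‖ = 1, q₄ ≤ 1 − δ}` ONTO `S⁴ ∖ λ(B_ρ)`** (registered helper of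
file N): into by the radius bound `1/Q ≥ ρ`, onto by the intermediate values of `Q`. [folklore] -/
theorem image_capMap (hδ : 0 < δ) (hδ1 : δ < 1) : capMap δ '' {q : EuclideanSpace ℝ (Fin 5) | ‖q‖ = 1 ∧ q 4 ≤ 1 - δ} = (liftS4 '' Metric.ball 0 (Real.sqrt (1 - (1 - δ) ^ 2)))ᶜ := by
  set ρ := Real.sqrt (1 - (1 - δ) ^ 2) with hρdef
  have hρ : 0 < ρ := Real.sqrt_pos.2 (by nlinarith)
  ext z
  constructor
  · rintro ⟨q, ⟨hq1, hq4⟩, rfl⟩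
    exact capMap_notMem_image_ball hδ hδ1 hq1 hq4
  · intro hz
    by_cases hzN : z = northPole
    · -- the south pole
      refine ⟨-(northPole : Metric.sphere (0 : EuclideanSpace ℝ (Fin 5)) 1), ⟨by simp, ?_⟩, ?_⟩
      · show (-(northPole : Metric.sphere (0 : EuclideanSpace ℝ (Fin 5)) 1) : EuclideanSpace ℝ (Fin 5)) 4 ≤ 1 - δ
        simp [northPole]; linarith
      · rw [hzN]
        apply capMap_of_proj5_eq_zero
        ext i
        fin_cases i <;> simp [proj5, northPole]
    · -- `z = λ w`, `‖w‖ ≥ ρ`: solve `Q(t) = 1/‖w‖`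
      obtain ⟨w, rfl⟩ : z ∈ range liftS4 := by rw [range_liftS4]; exact hzN
      have hwρ : ρ ≤ ‖w‖ := not_lt.1 fun hlt => hz ⟨w, mem_ball_zero_iff.2 hlt, rfl⟩
      have hw0 : 0 < ‖w‖ := lt_of_lt_of_le hρ hwρ
      obtain ⟨t, ht1, ht2, htQ⟩ := exists_capQ_eq hδ hδ1 (inv_pos.2 hw0) ((inv_le_inv₀ hw0 hρ).2 hwρ)
      have ht3 : t < 1 := by linarith
      have h1t : 0 < 1 - t ^ 2 := by nlinarith
      have hsq : 0 < Real.sqrt (1 - t ^ 2) := Real.sqrt_pos.2 h1t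
      set x : EuclideanSpace ℝ (Fin 4) := (Real.sqrt (1 - t ^ 2) / ‖w‖) • w with hx
      have hxnorm : ‖x‖ = Real.sqrt (1 - t ^ 2) := by
        rw [hx, norm_smul, Real.norm_of_nonneg (by positivity), div_mul_cancel₀ _ hw0.ne']
      set q : EuclideanSpace ℝ (Fin 5) := embedL x + t • e4 with hq
      have hq4 : q 4 = t := by simp [hq, embedL_apply]
      have hqx : proj5 q = x := by
        rw [hq, proj5_add, proj5_smul, proj5_embedL, proj5_e4, smul_zero, add_zero]
      have hq1 : ‖q‖ = 1 := by
        have h1 : ‖q‖ ^ 2 = 1 := by rw [hq, norm_sq_embedL_add_smul, hxnorm, Real.sq_sqrt h1t.le]; ring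
        nlinarith [norm_nonneg q]
      have hxne : proj5 q ≠ 0 := by rw [hqx, ← norm_ne_zero_iff, hxnorm]; exact hsq.ne'
      refine ⟨q, ⟨hq1, by rw [hq4]; exact ht2⟩, ?_⟩
      rw [capMap_eq_liftS4_smul hδ1 hq1 (by rw [hq4]; exact ht3) hxne, hqx, hq4]
      congr 1
      -- `(P/(1-t²)) • x = w`
      rw [hx, smul_smul]
      have hcoef : capP δ t / (1 - t ^ 2) * (Real.sqrt (1 - t ^ 2) / ‖w‖) = 1 := by
        have hQ : capQ δ t = ‖w‖⁻¹ := htQ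
        have hP := capP_pos hδ1 ht3
        have hss : Real.sqrt (1 - t ^ 2) * Real.sqrt (1 - t ^ 2) = 1 - t ^ 2 := Real.mul_self_sqrt h1t.le
        rw [capQ, div_eq_iff hP.ne', inv_mul_eq_div, eq_div_iff hw0.ne'] at hQ
        -- `hQ : √(1 - t²) * ‖w‖ = P`
        calc capP δ t / (1 - t ^ 2) * (Real.sqrt (1 - t ^ 2) / ‖w‖)
            = (Real.sqrt (1 - t ^ 2) * Real.sqrt (1 - t ^ 2)) * (‖w‖ / ‖w‖) / (1 - t ^ 2) := by rw [← hQ]; ring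
          _ = 1 := by rw [hss, div_self hw0.ne', mul_one, div_self h1t.ne']
      rw [hcoef, one_smul]

end Basic

end Summit.SmoothPoincare4.SmoothPoincare4.Theorems.OrigamiFoldExistence.ShadowPleats

end
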